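import Summits.BirchSwinnertonDyer.BirchSwinnertonDyer.Theorems.ClassRecordThreeCornerTwistWitnessDefs
import Summits.BirchSwinnertonDyer.Rank1Residual.X11b.Three.CornerDischarge
import HarnessLib

/-!
# Routes `ClassRecordThree` ∕ `KolyvaginRoadThree` (rung K2@3), crux `CornerAtThreeW` (item stmt-BirchSwinnertonDyer-21420;
# 19111 `CornerAtThree` aside): the TWO-TWIN HALF-SQUEEZE of the (W) conjunct — definitions home
# (cell `bsd-stepL`, seat `bsd-stepL-corner3-p2` g6 = WIDTH-LEVER lane B, executing the ideation planner's prover ticket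
# T-g8-1 for crux idea card J «two-twin half-squeeze at 3», `Cruxes/CornerAtThreeW/Ideas/two-twin-half-squeeze-at-3.md`)

`--supports stmt-BirchSwinnertonDyer-21420 --as helper`. Theses-free (imports NO `Theses/` and NO `Cruxes/` module), so both
route files wanting item 21420 may import it and name the objects. Contents: ONE plain predicate (`IsTwinFrame`, decidable
bookkeeping of an odd Heegner twin frame), FOUR `Prop`-valued typed OPEN inputs tagged `@[conjecture]` (each implied by
`BSD₃` of one Hoffstein–Luo twist; nothing asserted), two elementary supplies and two bookkeeping theorems (each half is
WEAKER than the filed one-twin witness `Theorems.CornerTwistWitness.CornerTwistWitnessAt`, item 21420's (W) conjunct).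
NO named fact, no instance, no notation, no `sorry`. The consumer replays (each corner consumer needs only ITS half, at ITS
twin) are the sibling module `ClassRecordThreeCornerTwinHalves.lean`.

## Why (card J, memo `run/shared/lean/pub/bsd-stepL/corner/mult-idea-g8/LENS-MEMO-mult-idea-g8.md` §1(α), §2)

The (W) conjunct `CornerTwistWitnessAt W` asks the FULL rank-`0` `3`-part of BSD, `BSDp Wd 3`, of ONE odd Heegner twin.
But the two corner consumers use OPPOSITE halves of it: the upper kernel (`X11b.Three.missingUpperBoundAt_of_shaIndexBound_sharp`)
consumes only the twin's `≥`-half — a LOWER bound `ord₃ L(E^d,1)/Ω(E^d) ≤ ord₃ #Ш(E^d) + ord₃ ∏c(E^d) − 2·ord₃ #tors(E^d)` —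
and the lower kernel (`X11b.Three.missingLowerBoundAt_of_indexLowerBoundAt`) only the twin's `≤`-half (Kato's shape), each at
ONE existentially chosen field. So the two halves may be supplied at TWO DIFFERENT twins: `CornerTwinLowerAt W` (F1′; FREE
at an exact-valuation twin, `twinLower_of_exact` — the cell's census `run/shared/lean/pub/bsd-stepL/mult-p3/census-g5/`
exhibits an exact odd Heegner twin for 296 ∕ 296 corner pairs `N < 5·10⁵`, EVIDENCE only, T7) and `CornerTwinUpperAt W`
(F2′; free at a twin with `Ш(E^d)[3] = 0` and `ord₃ ∏c − 2 ord₃ #tors ≤ ord₃ L/Ω`, `twinUpper_of_sha_unit` — a `3`-descent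
certificate per pair), and `BSD₃` of NO twin is ever needed. Both are implied by `CornerTwistWitnessAt W`
(`cornerTwinLowerAt_of_cornerTwistWitnessAt`, `cornerTwinUpperAt_of_cornerTwistWitnessAt`), so re-gluing (W) into the two
halves loses nothing. Bodies VERBATIM = the planner's kernel-checked `Sketch.lean` §α (sha16 dd92dcf211d2cdad, evidence #5 on
item 21420), namespace moved here.

HONEST FRAMING: typed SHAPES and bookkeeping; CONDITIONAL everywhere they are used; nothing booked; no census word, tier or
label moves (T7); item 21420 is NOT closed; class-wide F2′ is conjecture-grade (barrier `EulerSystemBigImageAtSmallImage` bites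
every twin: image `N(C)` prime to `3`, no transvection); BSD(E,3) is proved for no class by this file.

References: [Miller2011LMS] Def. 1.1 (arXiv:1010.2431 p. 3); [HoffsteinLuo1997] Theorem (§1, pp. 435–436);
[JetchevSkinnerWan2017] §7.4.1–§7.4.2 (pp. 30–31: the two halves of the twin in the Gross–Zagier–Kolyvagin descent);
[Skinner2016PacificMC] Thm. C (shape of the `≥`-half); [Kato2004Asterisque] Thm. 17.4 (shape of the `≤`-half); card J
(`Cruxes/CornerAtThreeW/Ideas/two-twin-half-squeeze-at-3.md`); cell board RULING 33 ∕ T-g8-1 (2026-08-27).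
-/

set_option linter.dupNamespace false

open scoped Classical

open WeierstrassCurve NumberField IsDedekindDomain Field Literature.NumberTheory.EllipticCurves
  Rat.HeightOneSpectrum
  Literature.NumberTheory.DiophantineGeometry
  Literature.NumberTheory.EllipticCurves.GreenbergSelmer
  Literature.NumberTheory.EllipticCurves.ModularForms
  Literature.NumberTheory.EllipticCurves.Rank1Residual
  Literature.NumberTheory.EllipticCurves.Rank1Residual.Typed
  Literature.NumberTheory.EllipticCurves.Wuthrich2014
  Literature.NumberTheory.EllipticCurves.BalakrishnanEtAl2019
  Literature.NumberTheory.QuadraticFields.Quadratic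
  Literature.NumberTheory.Automorphic
  Literature.NumberTheory.GaloisRepresentations Literature.NumberTheory.GaloisCohomology
  Summit.BirchSwinnertonDyer.Rank1Residual.X11b.AcSelmer
  Summit.BirchSwinnertonDyer.Rank1Residual.X11b.LocBridge
  Summit.BirchSwinnertonDyer.Rank1Residual
  Summit.BirchSwinnertonDyer.Rank1Residual.X11b
  Summit.BirchSwinnertonDyer.Rank1Residual.X11b.Three
  Summit.BirchSwinnertonDyer.BirchSwinnertonDyer.Theorems.CornerTwistWitness

namespace Summit.BirchSwinnertonDyer.BirchSwinnertonDyer.Theorems.CornerTwinHalves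

/-- An odd Heegner twin FRAME of a corner curve (plain bookkeeping predicate, nothing asserted): an imaginary quadratic
`K` with odd `d_K < -4`, Heegner for `N(E)` and for `3` (so `3` split, `w_K = 2`), `L(E^{(d_K)},1) ≠ 0`, and a global minimal
model `Wd = Cd • E^{(d_K)}` of the twist — the first seven conjuncts of `CornerTwistWitness.CornerTwistWitnessAt` VERBATIM.
[cite: HoffsteinLuo1997, Theorem (§1, pp. 435–436) (such frames exist; shape only)] -/
def IsTwinFrame (W : WeierstrassCurve ℚ) [W.IsElliptic] (K : Type) [Field K] [NumberField K]
    (Wd : WeierstrassCurve ℚ) (Cd : VariableChange ℚ) : Prop :=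
  IsImaginaryQuadratic K ∧ Odd (NumberField.discr K) ∧ NumberField.discr K < -4 ∧
    SatisfiesHeegnerHypothesis (W.conductorNorm ℤ) K ∧ SatisfiesHeegnerHypothesis 3 K ∧
    (W.quadraticTwist (NumberField.discr K : ℚ)).entireLFunction 1 ≠ 0 ∧
    Cd • W.quadraticTwist (NumberField.discr K : ℚ) = Wd

/-- OPEN (typed open input; implied by the `≥`-half of `BSD(E^{d_K},3)` for one Hoffstein–Luo twist) — **F1′,
`CornerTwinLowerAt W`: a twin frame carrying the LOWER half** `ord₃ L(E^d,1)/Ω(E^d) ≤ ord₃ #Ш(E^d) + ord₃ ∏c(E^d) − 2·ord₃ #tors(E^d)`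
(the half a main-conjecture argument would give — Skinner 2016 Thm. C's display, VOID in print on the rank-`0` corner (no (ram)
prime); FREE at an exact-valuation twin, where `ord₃ L/Ω ≤ ord₃ ∏c − 2 ord₃ #tors`: `twinLower_of_exact`). For `W/ℚ` globally
minimal with `(E,3) ∈` X11b and `ρ̄_{E,3}` NOT surjective. Exactly what the UPPER corner consumer
(`X11b.Three.missingUpperBoundAt_of_shaIndexBound_sharp`) uses of the twin. WEAKER than `CornerTwistWitnessAt W`
(`cornerTwinLowerAt_of_cornerTwistWitnessAt`). A predicate on `W`; NEVER a theorem in this cell; CONDITIONAL wherever used.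
[cite: Skinner2016PacificMC, Thm. C (display shape of the `≥`-half; VOID here — nothing asserted)]
[cite: JetchevSkinnerWan2017, §7.4.2 (eq:shaupper), p. 31 (where the half is consumed)] -/
@[conjecture]
def CornerTwinLowerAt (W : WeierstrassCurve ℚ) [W.IsElliptic] [W.IsGloballyMinimal] : Prop :=
  ClassX11b W 3 → ¬ Surj W 3 →
    ∃ (K : Type) (_ : Field K) (_ : NumberField K)
      (Wd : WeierstrassCurve ℚ) (_ : Wd.IsElliptic) (_ : Wd.IsGloballyMinimal) (Cd : VariableChange ℚ),
      IsTwinFrame W K Wd Cd ∧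
        ∃ q : ℚ, Wd.entireLFunction 1 / (Wd.realPeriodRat : ℂ) = (q : ℂ) ∧
          padicValRat 3 q ≤ (padicValNat 3 Wd.shaOrder : ℤ) + padicValNat 3 Wd.tamagawaProduct -
            2 * padicValNat 3 Wd.torsionOrder

/-- OPEN (typed open input; implied by the `≤`-half of `BSD(E^{d_K},3)` for one Hoffstein–Luo twist) — **F2′,
`CornerTwinUpperAt W`: a (possibly different) twin frame carrying the UPPER half**
`ord₃ #Ш(E^d) + ord₃ ∏c(E^d) − 2·ord₃ #tors(E^d) ≤ ord₃ L(E^d,1)/Ω(E^d)` (Kato 2004 Thm. 17.4's shape, VOID in print at image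
`N(C)`; FREE at a twin with `Ш(E^d)[3] = 0` and `ord₃ ∏c − 2 ord₃ #tors ≤ ord₃ L/Ω`, e.g. by a `3`-descent certificate:
`twinUpper_of_sha_unit`). For `W/ℚ` globally minimal with `(E,3) ∈` X11b and `ρ̄_{E,3}` NOT surjective. Exactly what the LOWER
corner consumer (`X11b.Three.missingLowerBoundAt_of_indexLowerBoundAt`) uses of the twin. WEAKER than `CornerTwistWitnessAt W`
(`cornerTwinUpperAt_of_cornerTwistWitnessAt`). A predicate on `W`; NEVER a theorem in this cell; CONDITIONAL wherever used;
class-wide it is conjecture-grade (barrier `EulerSystemBigImageAtSmallImage`).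
[cite: Kato2004Asterisque, Thm. 17.4 (display shape of the `≤`-half; VOID here — nothing asserted)]
[cite: JetchevSkinnerWan2017, §7.4.1 (eq:shalowerK-1), p. 30 (where the half is consumed)] -/
@[conjecture]
def CornerTwinUpperAt (W : WeierstrassCurve ℚ) [W.IsElliptic] [W.IsGloballyMinimal] : Prop :=
  ClassX11b W 3 → ¬ Surj W 3 →
    ∃ (K : Type) (_ : Field K) (_ : NumberField K)
      (Wd : WeierstrassCurve ℚ) (_ : Wd.IsElliptic) (_ : Wd.IsGloballyMinimal) (Cd : VariableChange ℚ),
      IsTwinFrame W K Wd Cd ∧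
        ∃ q : ℚ, Wd.entireLFunction 1 / (Wd.realPeriodRat : ℂ) = (q : ℂ) ∧
          (padicValNat 3 Wd.shaOrder : ℤ) + padicValNat 3 Wd.tamagawaProduct -
            2 * padicValNat 3 Wd.torsionOrder ≤ padicValRat 3 q

/-- OPEN — **`CornerTwinLower`**: the class-wide form of F1′ (`∀ W, CornerTwinLowerAt W`), the proposed replacement item for
the `≥`-half of the (W) conjunct of crux `CornerAtThreeW` (card J re-glue; planner action). A `Prop` constant; nothing asserted.
[cite: Skinner2016PacificMC, Thm. C (shape only)] -/
@[conjecture]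
def CornerTwinLower : Prop :=
  ∀ (W : WeierstrassCurve ℚ) [W.IsElliptic] [W.IsGloballyMinimal], CornerTwinLowerAt W

/-- OPEN — **`CornerTwinUpper`**: the class-wide form of F2′ (`∀ W, CornerTwinUpperAt W`), the proposed replacement item for
the `≤`-half of the (W) conjunct of crux `CornerAtThreeW` (card J re-glue; planner action). A `Prop` constant; nothing asserted.
[cite: Kato2004Asterisque, Thm. 17.4 (shape only)] -/
@[conjecture]
def CornerTwinUpper : Prop :=
  ∀ (W : WeierstrassCurve ℚ) [W.IsElliptic] [W.IsGloballyMinimal], CornerTwinUpperAt W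

/-! ### Elementary supplies (why each half is free at the right kind of twin) -/

/-- **F1′ is free at an EXACT twin**: `ord₃ L/Ω ≤ ord₃ ∏c − 2 ord₃ #tors` (the (TC₃ᵗ) certificate shape of a census row)
gives the lower half, since `0 ≤ ord₃ #Ш`. Elementary. -/
theorem twinLower_of_exact (Wd : WeierstrassCurve ℚ) (q : ℚ)
    (h : padicValRat 3 q ≤ (padicValNat 3 Wd.tamagawaProduct : ℤ) - 2 * padicValNat 3 Wd.torsionOrder) :
    padicValRat 3 q ≤ (padicValNat 3 Wd.shaOrder : ℤ) + padicValNat 3 Wd.tamagawaProduct -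
      2 * padicValNat 3 Wd.torsionOrder := by
  have : (0 : ℤ) ≤ (padicValNat 3 Wd.shaOrder : ℤ) := by exact_mod_cast Nat.zero_le _
  omega

/-- **F2′ is free at a twin with `3 ∤ #Ш(E^d)`** and `ord₃ ∏c − 2 ord₃ #tors ≤ ord₃ L/Ω` (a `3`-descent certificate plus a
modular-symbol value): the upper half holds with `ord₃ #Ш = 0`. Elementary. -/
theorem twinUpper_of_sha_unit (Wd : WeierstrassCurve ℚ) (q : ℚ) (hsha : ¬ 3 ∣ Wd.shaOrder)
    (h : (padicValNat 3 Wd.tamagawaProduct : ℤ) - 2 * padicValNat 3 Wd.torsionOrder ≤ padicValRat 3 q) :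
    (padicValNat 3 Wd.shaOrder : ℤ) + padicValNat 3 Wd.tamagawaProduct -
      2 * padicValNat 3 Wd.torsionOrder ≤ padicValRat 3 q := by
  have : padicValNat 3 Wd.shaOrder = 0 := padicValNat.eq_zero_of_not_dvd hsha
  omega

/-! ### The recut is WEAKER than the filed one-twin witness `CornerTwistWitnessAt` (item 21420 conjunct) -/

/-- **F1′ ⟸ (W)**: the one-twin witness `CornerTwistWitnessAt W` (full `BSDp Wd 3` of one Hoffstein–Luo twist) gives the
twin's `≥`-half at that frame (`exists_LOne_div_realPeriodRat_of_bsdp_rankZero`, rank `0` by modularity). Bookkeeping;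
CONDITIONAL on `hGZK`, `hmod` and (W). [cite: Miller2011LMS, Def. 1.1] -/
theorem cornerTwinLowerAt_of_cornerTwistWitnessAt (hGZK : rank_eq_analyticRank_of_analyticRank_le_one)
    (hmod : hasEntireLFunction_rat) (W : WeierstrassCurve ℚ) [W.IsElliptic] [W.IsGloballyMinimal]
    (hWit : CornerTwistWitnessAt W) : CornerTwinLowerAt W := by
  intro hX hns
  obtain ⟨K, _, _, Wd, _, _, Cd, hK, hodd, hlt, hHN, hH3, hLt, hWd, hbsd⟩ := hWit hX hns
  have hD0 : (NumberField.discr K : ℚ) ≠ 0 := by exact_mod_cast NumberField.discr_ne_zero K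
  haveI hEt : (W.quadraticTwist (NumberField.discr K : ℚ)).IsElliptic := W.isElliptic_quadraticTwist hD0
  have hLt' : (W.quadraticTwist (NumberField.discr K : ℚ)).entireLFunction = Wd.entireLFunction := by
    rw [← hWd, entireLFunction_smul]
  have hLd1 : Wd.entireLFunction 1 ≠ 0 := by rw [← hLt']; exact hLt
  have hrd : Wd.analyticRank = 0 := (Wd.analyticRank_eq_zero_iff_holds (hmod Wd)).2 hLd1
  obtain ⟨qd, hqd, hvqd⟩ := exists_LOne_div_realPeriodRat_of_bsdp_rankZero hGZK hmod Wd 3 hrd hbsd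
  exact ⟨K, inferInstance, inferInstance, Wd, inferInstance, inferInstance, Cd,
    ⟨hK, hodd, hlt, hHN, hH3, hLt, hWd⟩, qd, hqd, hvqd.le⟩

/-- **F2′ ⟸ (W)**: the one-twin witness gives the twin's `≤`-half at that frame. Bookkeeping; CONDITIONAL on `hGZK`,
`hmod` and (W). [cite: Miller2011LMS, Def. 1.1] -/
theorem cornerTwinUpperAt_of_cornerTwistWitnessAt (hGZK : rank_eq_analyticRank_of_analyticRank_le_one)
    (hmod : hasEntireLFunction_rat) (W : WeierstrassCurve ℚ) [W.IsElliptic] [W.IsGloballyMinimal]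
    (hWit : CornerTwistWitnessAt W) : CornerTwinUpperAt W := by
  intro hX hns
  obtain ⟨K, _, _, Wd, _, _, Cd, hK, hodd, hlt, hHN, hH3, hLt, hWd, hbsd⟩ := hWit hX hns
  have hD0 : (NumberField.discr K : ℚ) ≠ 0 := by exact_mod_cast NumberField.discr_ne_zero K
  haveI hEt : (W.quadraticTwist (NumberField.discr K : ℚ)).IsElliptic := W.isElliptic_quadraticTwist hD0
  have hLt' : (W.quadraticTwist (NumberField.discr K : ℚ)).entireLFunction = Wd.entireLFunction := by
    rw [← hWd, entireLFunction_smul]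
  have hLd1 : Wd.entireLFunction 1 ≠ 0 := by rw [← hLt']; exact hLt
  have hrd : Wd.analyticRank = 0 := (Wd.analyticRank_eq_zero_iff_holds (hmod Wd)).2 hLd1
  obtain ⟨qd, hqd, hvqd⟩ := exists_LOne_div_realPeriodRat_of_bsdp_rankZero hGZK hmod Wd 3 hrd hbsd
  exact ⟨K, inferInstance, inferInstance, Wd, inferInstance, inferInstance, Cd,
    ⟨hK, hodd, hlt, hHN, hH3, hLt, hWd⟩, qd, hqd, hvqd.ge⟩

end Summit.BirchSwinnertonDyer.BirchSwinnertonDyer.Theorems.CornerTwinHalves
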